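import Summits.BirchSwinnertonDyer.Rank1Residual.GaloisImage.KolyvaginStubVanishing
import HarnessLib

/-!
# Stub vanishing at `m = 1`, sequel: the `χ = 1` reading (`κ_d ≠ 0 ⟹ κ_d` generates the line
# `H¹_{𝓕(d)}`) and the prime choice in the printed currencies (Rubin Prop. 2.7.1; Sakamoto Cor. 5.5)
# (cell `b2b-bsdres`, team n1011, ROUTE-1 item R1-56 sub-item K6; row T-R1-56-K6, seat p09 GEN 6;
# skeleton `cells/n1011/skel/T-R1-56-K6.md`; file 2 of the row)

HONEST FRAMING (verbatim for the cell): research route on the CONSTRUCTION-SHAPED class X4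
(N11 = X4 ∧ `p = 3`); prove what is provable now; shrink each hard class to its core with data; no
claim beyond stated classes; nothing booked; no mark / label moved.  TOOL theorems about Kolyvagin
systems of a finite Galois module; theorems only — no definition, no named fact, no conjecture node.

File 1 (`KolyvaginStubVanishing`) proves Mazur–Rubin Thm. 4.3.4 / Rubin PCMI Thm. 2.8.4 at `m = 1`
for any core rank: a Kolyvagin system `κ ∈ KS₁(T̄, 𝓕, 𝒫)` vanishes at every level `d` with
`H¹_{𝓕(d)^*}(K, T̄^*) ≠ 0`, the prime choice being the level-wise binder `hprime`.  Here:

* §C′ the `χ = 1` reading (Rubin Thm. 2.8.4 as printed, with Ex. 2.5.4 (2) and Ex. 2.1.4):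
  `natCard_selmerGroup_atLevel_eq_of_hasCoreRank_one_of_apply_ne_zero` — `κ_d ≠ 0 ⟹ d` is a core
  vertex and `#H¹_{𝓕(d)}(K, T̄) = p` (p11's `card_selmerGroup_atLevel_mul` + file 1); and
  `selmerGroup_atLevel_eq_zmultiples_of_apply_ne_zero` — `κ_d` GENERATES `H¹_{𝓕(d)}` (the `m = 1`
  content of Sakamoto's Thm. 4.4 (2) at every level where `κ_d ≠ 0`; Rubin Prop. 2.9.3 (1)).
* §D the vanishing `κ_d ≠ 0 ⟹ H¹_{𝓕(d)^*} = 0` with the prime choice in Rubin's "infinitely many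
  primes" shape (`…_of_infinite`, Prop. 2.7.1) and in Sakamoto's residual-self-duality shape
  (`…_of_selfDual`: JTNB 36 (2024) Cor. 5.5, three classes of `H¹(K, T̄)`, the dual class
  transported by an equivariant `θ' : T̄^∨(1) → T̄` injective on `H¹`) — p11's §9 pattern; for
  `T̄ = E[p]`, `p` odd, `ρ̄_{E,p}` onto, `hC55` is n1011-p15's THEOREM
  `PrimeChoice.hC55_of_hasSurjectiveModNGaloisRep`.

Hypothesis ledger as in file 1 (+ `hχ`, `hU` in §C′ only; + `θ'`, `hθ'`, `hC55` in §D).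

References: [Rubin2011] Ex. 2.1.4 (p. 18), Ex. 2.5.4 (p. 21), Prop. 2.7.1 (p. 23), Thm. 2.8.4
(p. 25), Prop. 2.9.3 (p. 26); [MazurRubin2004] Thm. 4.3.4 (p. 45), Prop. 3.6.1 (p. 30);
[Sakamoto2024] Thm. 4.4 (2) (p. 926), Cor. 5.5 (p. 929).
-/

noncomputable section

open scoped Classical NumberField ContRepresentation
open Function NumberField IsDedekindDomain
open Literature.NumberTheory.GaloisRepresentations Literature.NumberTheory.GaloisRepresentations.DiscreteGaloisModule
  Literature.NumberTheory.GaloisCohomology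

universe u

namespace Summit.BirchSwinnertonDyer.Rank1Residual.GaloisImage.CoreRankZero

variable {K : Type u} [Field K] [NumberField K]
variable {M : Type u} [AddCommGroup M] [TopologicalSpace M] [DiscreteTopology M] [Finite M]
variable {ρ : DiscreteGaloisModule K M}

/-! ## §C′. The `χ = 1` reading: `κ_d ≠ 0 ⟹ κ_d` generates the line `H¹_{𝓕(d)}` -/

/-- **The `χ = 1` reading (Rubin Thm. 2.8.4 as printed, with Ex. 2.5.4 (2)): `κ_d ≠ 0 ⟹ d` is a
core vertex and `H¹_{𝓕(d)}(K, T̄)` is a LINE, `#H¹_{𝓕(d)} = p`.**  With `χ(𝓕) = 1`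
(`#H¹_𝓕 = p · #H¹_{𝓕^*}`) the core rank is `1` at every level (p11's `card_selmerGroup_atLevel_mul`,
Rubin Ex. 2.1.4, which needs `#H¹_ur(K_𝔮, T̄) = #H¹_tr(K_𝔮, T̄)`, binder `hU`), and the dual Selmer
group at `d` is trivial by `dualSelmerGroup_atLevel_eq_bot_of_apply_ne_zero`.
[cite: Rubin2011, Thm. 2.8.4 (p. 25), Ex. 2.5.4 (2) (p. 21), Ex. 2.1.4 (p. 18)] -/
theorem natCard_selmerGroup_atLevel_eq_of_hasCoreRank_one_of_apply_ne_zero {p : ℕ} [Fact p.Prime]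
    {inv : LocalInvariants K p}
    (hperf : inv.IsPerfect) (hsum : inv.SumLocalTermEqZero) (hcompl : inv.SelmerComplement)
    (hM : ∀ m : M, p • m = 0) {S : Finset (Place K)}
    (hS : ∀ v : HeightOneSpectrum (𝓞 K), (Sum.inr v : Place K) ∉ S →
      ((p : ℕ) : 𝓞 K) ∉ v.asIdeal ∧ GaloisRep.IsUnramifiedAt v ρ)
    {𝓕 : SelmerStructure ρ} (h𝓕 : 𝓕.IsUnramifiedOutside S)
    (hfin : Finite 𝓕.selmerGroup) (hfind : Finite (inv.dualSelmerStructure ρ 𝓕).selmerGroup)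
    (hχ : LocalInvariants.HasCoreRank inv 𝓕 p 1)
    {D : KolyvaginDatum ρ} (hPS : ∀ q ∈ D.primes, (Sum.inr q : Place K) ∉ S)
    (hadm : D.IsAdmissible)
    (hU : ∀ q ∈ D.primes, Nat.card (unramifiedSubgroup (GaloisRep.toLocal q ρ) 1) = p)
    (hT : ∀ q ∈ D.primes, Nat.card (D.transverse (Sum.inr q)) = p)
    (hUT : ∀ q ∈ D.primes,
      unramifiedSubgroup (GaloisRep.toLocal q ρ) 1 ⊔ D.transverse (Sum.inr q) = ⊤)
    (hprime : ∀ d, D.IsLevel d → ∀ c ∈ (D.atLevel 𝓕 d).selmerGroup,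
      ∀ c' ∈ (inv.dualSelmerStructure ρ (D.atLevel 𝓕 d)).selmerGroup, c ≠ 0 → c' ≠ 0 →
        ∃ q ∈ D.primes, q ∉ d ∧ galoisCohomology.localization ρ (Sum.inr q) 1 c ≠ 0 ∧
          galoisCohomology.localization (ρ.tateDual p) (Sum.inr q) 1 c' ≠ 0)
    {κ : Finset (HeightOneSpectrum (𝓞 K)) → galoisCohomology ρ 1} (hκ : D.IsKolyvaginSystem 𝓕 κ)
    {d : Finset (HeightOneSpectrum (𝓞 K))} (hd : D.IsLevel d) (hκd : κ d ≠ 0) :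
    Nat.card (D.atLevel 𝓕 d).selmerGroup = p := by
  haveI := finite_selmerGroup_atLevel D 𝓕 hfin d
  have hbot := dualSelmerGroup_atLevel_eq_bot_of_apply_ne_zero hperf hsum hcompl hM hS h𝓕 hfin hfind
    hPS hadm hT hUT hprime hκ hd hκd
  have hmul := card_selmerGroup_atLevel_mul hperf hsum hcompl hM hS h𝓕 hfin hfind hPS
    (fun q hq => by rw [hU q hq, hT q hq]) hd
  rw [LocalInvariants.HasCoreRank, pow_one] at hχ
  rw [hbot, AddSubgroup.card_bot, mul_one, hχ] at hmul
  have hFd : Nat.card (inv.dualSelmerStructure ρ 𝓕).selmerGroup ≠ 0 := Nat.card_pos.ne'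
  refine mul_right_cancel₀ hFd ?_
  rw [hmul, mul_comm]

/-- **`κ_d` GENERATES `H¹_{𝓕(d)}(K, T̄)` whenever it is non-zero (`χ = 1`, `m = 1`)**: the Selmer
group at the level `d` is then of prime order `p`
(`natCard_selmerGroup_atLevel_eq_of_hasCoreRank_one_of_apply_ne_zero`), so any non-zero element
generates it.  This is the `m = 1` content of Sakamoto's Thm. 4.4 (2) at the levels where `κ_d ≠ 0`
("`I_R(κ_d) = Fitt⁰_R(H¹_{𝓕^*(d)}(K, T^∨(1))^∨)`": unit ideal on both sides) and of Rubin's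
"`κ_n` generates `H′(n)`" (Prop. 2.9.3 (1)).
[cite: Rubin2011, Thm. 2.8.4 (p. 25) and Prop. 2.9.3 (p. 26)] [cite: Sakamoto2024, Thm. 4.4 (2) (p. 926)] -/
theorem selmerGroup_atLevel_eq_zmultiples_of_apply_ne_zero {p : ℕ} [Fact p.Prime]
    {inv : LocalInvariants K p}
    (hperf : inv.IsPerfect) (hsum : inv.SumLocalTermEqZero) (hcompl : inv.SelmerComplement)
    (hM : ∀ m : M, p • m = 0) {S : Finset (Place K)}
    (hS : ∀ v : HeightOneSpectrum (𝓞 K), (Sum.inr v : Place K) ∉ S →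
      ((p : ℕ) : 𝓞 K) ∉ v.asIdeal ∧ GaloisRep.IsUnramifiedAt v ρ)
    {𝓕 : SelmerStructure ρ} (h𝓕 : 𝓕.IsUnramifiedOutside S)
    (hfin : Finite 𝓕.selmerGroup) (hfind : Finite (inv.dualSelmerStructure ρ 𝓕).selmerGroup)
    (hχ : LocalInvariants.HasCoreRank inv 𝓕 p 1)
    {D : KolyvaginDatum ρ} (hPS : ∀ q ∈ D.primes, (Sum.inr q : Place K) ∉ S)
    (hadm : D.IsAdmissible)
    (hU : ∀ q ∈ D.primes, Nat.card (unramifiedSubgroup (GaloisRep.toLocal q ρ) 1) = p)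
    (hT : ∀ q ∈ D.primes, Nat.card (D.transverse (Sum.inr q)) = p)
    (hUT : ∀ q ∈ D.primes,
      unramifiedSubgroup (GaloisRep.toLocal q ρ) 1 ⊔ D.transverse (Sum.inr q) = ⊤)
    (hprime : ∀ d, D.IsLevel d → ∀ c ∈ (D.atLevel 𝓕 d).selmerGroup,
      ∀ c' ∈ (inv.dualSelmerStructure ρ (D.atLevel 𝓕 d)).selmerGroup, c ≠ 0 → c' ≠ 0 →
        ∃ q ∈ D.primes, q ∉ d ∧ galoisCohomology.localization ρ (Sum.inr q) 1 c ≠ 0 ∧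
          galoisCohomology.localization (ρ.tateDual p) (Sum.inr q) 1 c' ≠ 0)
    {κ : Finset (HeightOneSpectrum (𝓞 K)) → galoisCohomology ρ 1} (hκ : D.IsKolyvaginSystem 𝓕 κ)
    {d : Finset (HeightOneSpectrum (𝓞 K))} (hd : D.IsLevel d) (hκd : κ d ≠ 0) :
    (D.atLevel 𝓕 d).selmerGroup = AddSubgroup.zmultiples (κ d) := by
  have hp : p.Prime := Fact.out
  haveI := finite_selmerGroup_atLevel D 𝓕 hfin d
  have hcard := natCard_selmerGroup_atLevel_eq_of_hasCoreRank_one_of_apply_ne_zero hperf hsum hcompl hM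
    hS h𝓕 hfin hfind hχ hPS hadm hU hT hUT hprime hκ hd hκd
  have hmem : κ d ∈ (D.atLevel 𝓕 d).selmerGroup := hκ.mem_selmerGroup d hd
  have hle : AddSubgroup.zmultiples (κ d) ≤ (D.atLevel 𝓕 d).selmerGroup :=
    (AddSubgroup.zmultiples_le_of_mem hmem)
  -- the subgroup `ℤ κ_d` of the group `H¹_{𝓕(d)}` of prime order `p` is non-trivial, hence everything
  haveI : Finite (AddSubgroup.zmultiples (κ d)) := Finite.of_injective _ (AddSubgroup.inclusion_injective hle)
  obtain ⟨k, hk⟩ := AddSubgroup.card_dvd_of_le hle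
  rw [hcard] at hk
  have hz1 : Nat.card (AddSubgroup.zmultiples (κ d)) ≠ 1 := by
    intro h1
    have := AddSubgroup.card_eq_one.1 h1
    exact hκd (by simpa using (AddSubgroup.zmultiples_eq_bot.1 this))
  have hzp : Nat.card (AddSubgroup.zmultiples (κ d)) = p :=
    (hp.eq_one_or_self_of_dvd _ (Dvd.intro k hk.symm)).resolve_left hz1
  exact (AddSubgroup.eq_of_le_of_card_ge hle (by rw [hcard, hzp])).symm

/-! ## §D. The prime choice in the printed currencies (Rubin Prop. 2.7.1; Sakamoto Cor. 5.5) -/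

/-- **`κ_d ≠ 0 ⟹ H¹_{𝓕(d)^*} = 0`, with the prime choice in Rubin's "infinitely many primes" shape**
(Prop. 2.7.1: for non-zero `c ∈ H¹(K, M)`, `c' ∈ H¹(K, M^D)` the set
`{𝔮 ∈ 𝒫 : loc_𝔮 c ≠ 0 ∧ loc_𝔮 c' ≠ 0}` is infinite); a prime outside the finite level `d` is then
always available. [cite: Rubin2011, Prop. 2.7.1 (p. 23) and Thm. 2.8.4 (p. 25)] -/
theorem dualSelmerGroup_atLevel_eq_bot_of_apply_ne_zero_of_infinite {p : ℕ} [Fact p.Prime]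
    {inv : LocalInvariants K p}
    (hperf : inv.IsPerfect) (hsum : inv.SumLocalTermEqZero) (hcompl : inv.SelmerComplement)
    (hM : ∀ m : M, p • m = 0) {S : Finset (Place K)}
    (hS : ∀ v : HeightOneSpectrum (𝓞 K), (Sum.inr v : Place K) ∉ S →
      ((p : ℕ) : 𝓞 K) ∉ v.asIdeal ∧ GaloisRep.IsUnramifiedAt v ρ)
    {𝓕 : SelmerStructure ρ} (h𝓕 : 𝓕.IsUnramifiedOutside S)
    (hfin : Finite 𝓕.selmerGroup) (hfind : Finite (inv.dualSelmerStructure ρ 𝓕).selmerGroup)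
    {D : KolyvaginDatum ρ} (hPS : ∀ q ∈ D.primes, (Sum.inr q : Place K) ∉ S)
    (hadm : D.IsAdmissible)
    (hT : ∀ q ∈ D.primes, Nat.card (D.transverse (Sum.inr q)) = p)
    (hUT : ∀ q ∈ D.primes,
      unramifiedSubgroup (GaloisRep.toLocal q ρ) 1 ⊔ D.transverse (Sum.inr q) = ⊤)
    (hprime : ∀ c : galoisCohomology ρ 1, c ≠ 0 → ∀ c' : galoisCohomology (ρ.tateDual p) 1, c' ≠ 0 →
      {q ∈ D.primes | galoisCohomology.localization ρ (Sum.inr q) 1 c ≠ 0 ∧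
        galoisCohomology.localization (ρ.tateDual p) (Sum.inr q) 1 c' ≠ 0}.Infinite)
    {κ : Finset (HeightOneSpectrum (𝓞 K)) → galoisCohomology ρ 1} (hκ : D.IsKolyvaginSystem 𝓕 κ)
    {d : Finset (HeightOneSpectrum (𝓞 K))} (hd : D.IsLevel d) (hκd : κ d ≠ 0) :
    (inv.dualSelmerStructure ρ (D.atLevel 𝓕 d)).selmerGroup = ⊥ := by
  refine dualSelmerGroup_atLevel_eq_bot_of_apply_ne_zero hperf hsum hcompl hM hS h𝓕 hfin hfind hPS
    hadm hT hUT (fun d _ c _ c' _ hc hc' => ?_) hκ hd hκd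
  obtain ⟨q, ⟨hq, hcq, hc'q⟩, hqd⟩ := (hprime c hc c' hc').exists_notMem_finset d
  exact ⟨q, hq, hqd, hcq, hc'q⟩

/-- **`κ_d ≠ 0 ⟹ H¹_{𝓕(d)^*} = 0`, with the prime choice in Sakamoto's residual-self-duality shape**
(JTNB 36 (2024) Cor. 5.5, p. 929, printed for `p = 3` and the `τ`-class primes: three non-zero
classes of `H¹(K, T̄)` are simultaneously non-zero locally at infinitely many `𝔮 ∈ 𝒫`): the dual
class is transported to `H¹(K, T̄)` by an equivariant `θ' : T̄^∨(1) → T̄` injective on `H¹` (for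
`T̄ = E[p]`: the inverse Weil transport), `loc_𝔮 (H¹(θ') c') ≠ 0 ⟹ loc_𝔮 c' ≠ 0` by naturality
(p11's `localization_map_one_eq`).  For `T̄ = E[p]`, `p` odd, `ρ̄_{E,p}` onto, the binder `hC55` is
n1011-p15's THEOREM `PrimeChoice.hC55_of_hasSurjectiveModNGaloisRep`.
[cite: Sakamoto2024, Cor. 5.5 (p. 929)] [cite: Rubin2011, Thm. 2.8.4 (p. 25)] -/
theorem dualSelmerGroup_atLevel_eq_bot_of_apply_ne_zero_of_selfDual {p : ℕ} [Fact p.Prime]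
    {inv : LocalInvariants K p}
    (hperf : inv.IsPerfect) (hsum : inv.SumLocalTermEqZero) (hcompl : inv.SelmerComplement)
    (hM : ∀ m : M, p • m = 0) {S : Finset (Place K)}
    (hS : ∀ v : HeightOneSpectrum (𝓞 K), (Sum.inr v : Place K) ∉ S →
      ((p : ℕ) : 𝓞 K) ∉ v.asIdeal ∧ GaloisRep.IsUnramifiedAt v ρ)
    {𝓕 : SelmerStructure ρ} (h𝓕 : 𝓕.IsUnramifiedOutside S)
    (hfin : Finite 𝓕.selmerGroup) (hfind : Finite (inv.dualSelmerStructure ρ 𝓕).selmerGroup)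
    {D : KolyvaginDatum ρ} (hPS : ∀ q ∈ D.primes, (Sum.inr q : Place K) ∉ S)
    (hadm : D.IsAdmissible)
    (hT : ∀ q ∈ D.primes, Nat.card (D.transverse (Sum.inr q)) = p)
    (hUT : ∀ q ∈ D.primes,
      unramifiedSubgroup (GaloisRep.toLocal q ρ) 1 ⊔ D.transverse (Sum.inr q) = ⊤)
    (θ' : (ρ.tateDual p).toContRepresentation →ⁱL ρ.toContRepresentation)
    (hθ' : Injective (galoisCohomology.map θ' 1))
    (hC55 : ∀ c₁ c₂ c₃ : galoisCohomology ρ 1, c₁ ≠ 0 → c₂ ≠ 0 → c₃ ≠ 0 →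
      {q ∈ D.primes | galoisCohomology.localization ρ (Sum.inr q) 1 c₁ ≠ 0 ∧
        galoisCohomology.localization ρ (Sum.inr q) 1 c₂ ≠ 0 ∧
        galoisCohomology.localization ρ (Sum.inr q) 1 c₃ ≠ 0}.Infinite)
    {κ : Finset (HeightOneSpectrum (𝓞 K)) → galoisCohomology ρ 1} (hκ : D.IsKolyvaginSystem 𝓕 κ)
    {d : Finset (HeightOneSpectrum (𝓞 K))} (hd : D.IsLevel d) (hκd : κ d ≠ 0) :
    (inv.dualSelmerStructure ρ (D.atLevel 𝓕 d)).selmerGroup = ⊥ := by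
  refine dualSelmerGroup_atLevel_eq_bot_of_apply_ne_zero_of_infinite hperf hsum hcompl hM hS h𝓕 hfin
    hfind hPS hadm hT hUT (fun c hc c' hc' => ?_) hκ hd hκd
  have hc'' : galoisCohomology.map θ' 1 c' ≠ 0 := fun h => hc' (hθ' (by rw [h, map_zero]))
  refine (hC55 c _ _ hc hc'' hc'').mono fun q hq => ⟨hq.1, hq.2.1, fun h0 => hq.2.2.1 ?_⟩
  rw [localization_map_one_eq, h0]
  exact map_zero _

end Summit.BirchSwinnertonDyer.Rank1Residual.GaloisImage.CoreRankZero

end
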